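/-
Copyright (c) 2026 the pub-hodgecm-mathlib formalisation cell (harness21).  Prover seat hodgecm-mathlib-K2Liu-p13 (g2), Track B «K2-LIT»,
#184♮ = hLiu418 = `stmt-HodgeConjecture-24832`; Road I v3 organ U1-CT-ind STAGE 2 (Q2), file F5-o (the scalar modulus `D_T` of ★∕📤 F5-n, the product formula).
-/
import Literature.NumberTheory.Automorphic.AdelicRowVectorTwist          -- ★ `map_vecMul_eq_smul` (the module of `x ↦ x g` on `𝔸_Kⁿ`), `adelicAbsDet`
import Literature.NumberTheory.Automorphic.IdeleClassGroup               -- ★ `IdeleClassGroup.ideleNorm`, `ideleNorm_principal` (product formula)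
import Mathlib.Topology.Algebra.Module.Equiv
import HarnessLib

/-!
# Crux `HLiu418`, Road I v3, organ U1 stage 2 (Q2), file F5-o: THE MODULUS OF `t ↦ t·v` ON `𝔸_K` IS `‖v‖_𝔸⁻¹` (and `1` for principal `v`) —
# the scalar (`n = 1`) case of ★ `AdelicRowVectorTwist.map_vecMul_eq_smul`, for ★∕📤 F5-n's modulus `D_T` of the Klingen-Levi substitution

Cell `hodgecm-mathlib`, crux item hLiu418 = `stmt-HodgeConjecture-24832`; squad K2 ∕ K2Liu; LEAD F0P6-plan (g14), co-dealer K2E5-plan (g7); prover K2Liu-p13 (g2).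
THEOREMS ONLY (no `def`, no instance, no notation, no named-fact hypothesis, no `sorry`); lane `--supports stmt-HodgeConjecture-24832 --as helper` (count-neutral).
GENERIC number field `K`, any additive Haar measure `μ` on `𝔸_K`:
* **`map_mul_right_eq_ideleNorm_smul`**: `(t ↦ t·v)_*μ = ‖v⁻¹‖_𝔸 · μ` for `v ∈ 𝔸_K^×` (★ `map_vecMul_eq_smul` on `𝔸_K¹` transported along Mathlib's
  `ContinuousLinearEquiv.funUnique`, `g = unitsContinuousMulEquivOfUnique v`, `det g = v`); `map_mul_left_eq_ideleNorm_smul` (commutativity);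
* **`map_mul_right_eq_self_of_principal`**: `= μ` for principal `v = ι(u)`, `u ∈ K^×` (product formula ★ `ideleNorm_principal`).
With ★∕📤 F5-n `klingenInner_hscale` this makes ★ F5-c's `δ` EXPLICIT: `δ_b = ‖b₀₀‖_𝔸⁻¹·‖a‖…` — at `a = 1`, `δ_b = ‖b₀₀‖_{𝔸_L}⁻¹` (E1 parameter `s − ½`), and `δ = 1`
at rational `b` (left-`B₂(L⁺)`-invariance of the inner section).
[WeilBNT1967, Ch. IV §3 Cor. 1, §4 Thm. 5], [CasselsFrohlich1967, Ch. II §12, §16], [MoeglinWaldspurger1995, II.1.7].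
HONEST LABEL.  Count-neutral helper: `HC_CM` is proved only modulo the 7 printed citations (2 remaining named inputs: hLiu418 = `stmt-HodgeConjecture-24832`,
h413 = `stmt-HodgeConjecture-24833`) until rung 0 closes.
-/

set_option autoImplicit false
set_option linter.dupNamespace false -- the mandated namespace repeats `HodgeConjecture.HodgeConjecture`

noncomputable section

open scoped Matrix ENNReal NNReal
open NumberField IsDedekindDomain MeasureTheory MeasureTheory.Measure Function

namespace Summit.HodgeConjecture.HodgeConjecture.Cruxes.HLiu418.K2LiuAdelicScalarModulus

open Literature.NumberTheory.Automorphic Literature.NumberTheory.GaloisRepresentations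

variable {K : Type} [Field K] [NumberField K] [MeasurableSpace (AdeleRing (𝓞 K) K)] [BorelSpace (AdeleRing (𝓞 K) K)]

omit [MeasurableSpace (AdeleRing (𝓞 K) K)] [BorelSpace (AdeleRing (𝓞 K) K)] in
/-- the determinant of the `1 × 1` letter of a unit is the unit. [folklore] -/
theorem det_unitsContinuousMulEquivOfUnique (v : (AdeleRing (𝓞 K) K)ˣ) :
    Matrix.GeneralLinearGroup.det (FramedRep.unitsContinuousMulEquivOfUnique (Fin 1) (AdeleRing (𝓞 K) K) v) = v := by
  ext
  rw [Matrix.GeneralLinearGroup.val_det_apply, Matrix.det_unique]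
  rfl

/-- **THE MODULE OF `t ↦ t·v` ON `𝔸_K`**: `(t ↦ t·v)_*μ = ‖v⁻¹‖_𝔸 · μ` for every additive Haar measure `μ` and `v ∈ 𝔸_K^×` (★ `map_vecMul_eq_smul`, `n = 1`).
[cite: WeilBNT1967, Ch. IV §3 Cor. 1] -/
theorem map_mul_right_eq_ideleNorm_smul (μ : Measure (AdeleRing (𝓞 K) K)) [μ.IsAddHaarMeasure] (v : (AdeleRing (𝓞 K) K)ˣ) :
    μ.map (fun t => t * (v : AdeleRing (𝓞 K) K)) = ((IdeleClassGroup.ideleNorm K v⁻¹ : ℝ≥0) : ℝ≥0∞) • μ := by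
  haveI : SecondCountableTopology (AdeleRing (𝓞 K) K) := secondCountableTopology_adeleRing K
  haveI : LocallyCompactSpace (AdeleRing (𝓞 K) K) := locallyCompactSpace_adeleRing' K
  haveI : BorelSpace (Fin 1 → AdeleRing (𝓞 K) K) := Pi.borelSpace
  -- transport to `𝔸_K¹`
  set E : (Fin 1 → AdeleRing (𝓞 K) K) ≃L[AdeleRing (𝓞 K) K] AdeleRing (𝓞 K) K := ContinuousLinearEquiv.funUnique (Fin 1) (AdeleRing (𝓞 K) K) (AdeleRing (𝓞 K) K)
    with hE
  set ν : Measure (Fin 1 → AdeleRing (𝓞 K) K) := μ.map E.symm with hν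
  haveI : ν.IsAddHaarMeasure := E.symm.isAddHaarMeasure_map μ
  set g : GL (Fin 1) (AdeleRing (𝓞 K) K) := FramedRep.unitsContinuousMulEquivOfUnique (Fin 1) (AdeleRing (𝓞 K) K) v with hg
  have hmod := map_vecMul_eq_smul ν g
  have hdet : adelicAbsDet 1 K g⁻¹ = IdeleClassGroup.ideleNorm K v⁻¹ := by
    rw [adelicAbsDet_apply, map_inv, det_unitsContinuousMulEquivOfUnique]
  rw [hdet] at hmod
  -- `t ↦ t v` is `E ∘ (x ↦ x g) ∘ E⁻¹`
  have hfun : (fun t : AdeleRing (𝓞 K) K => t * (v : AdeleRing (𝓞 K) K)) = E ∘ (vecMulAddEquiv g) ∘ E.symm := by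
    funext t
    simp only [comp_apply, vecMulAddEquiv_apply, hE, ContinuousLinearEquiv.coe_funUnique, Function.eval]
    rw [Matrix.vecMul, dotProduct, Fintype.sum_unique]
    rfl
  have hEm : Measurable E := E.continuous.measurable
  have hEsm : Measurable E.symm := E.symm.continuous.measurable
  have hVm : Measurable (vecMulAddEquiv g) := (map_continuous (vecMulAddEquiv g)).measurable
  rw [hfun, ← Measure.map_map hEm (hVm.comp hEsm), ← Measure.map_map hVm hEsm, ← hν, hmod, Measure.map_smul, hν, Measure.map_map hEm hEsm]
  have hid : (E ∘ E.symm : AdeleRing (𝓞 K) K → AdeleRing (𝓞 K) K) = id := funext fun t => E.apply_symm_apply t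
  rw [hid, Measure.map_id]

/-- `(t ↦ v·t)_*μ = ‖v⁻¹‖_𝔸 · μ` (commutativity). [cite: WeilBNT1967, Ch. IV §3 Cor. 1] -/
theorem map_mul_left_eq_ideleNorm_smul (μ : Measure (AdeleRing (𝓞 K) K)) [μ.IsAddHaarMeasure] (v : (AdeleRing (𝓞 K) K)ˣ) :
    μ.map (fun t => (v : AdeleRing (𝓞 K) K) * t) = ((IdeleClassGroup.ideleNorm K v⁻¹ : ℝ≥0) : ℝ≥0∞) • μ := by
  simp_rw [mul_comm (v : AdeleRing (𝓞 K) K)]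
  exact map_mul_right_eq_ideleNorm_smul μ v

/-- **PRODUCT FORMULA**: `(t ↦ t·ι(u))_*μ = μ` for `u ∈ K^×` (★ `ideleNorm_principal`). [cite: WeilBNT1967, Ch. IV §4 Thm. 5] [cite: CasselsFrohlich1967, Ch. II §16] -/
theorem map_mul_right_eq_self_of_principal (μ : Measure (AdeleRing (𝓞 K) K)) [μ.IsAddHaarMeasure] {v : (AdeleRing (𝓞 K) K)ˣ}
    (hv : v ∈ principalIdeles K) :
    μ.map (fun t => t * (v : AdeleRing (𝓞 K) K)) = μ := by
  rw [map_mul_right_eq_ideleNorm_smul μ v, ideleNorm_principal (inv_mem hv), ENNReal.coe_one, one_smul]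

omit [MeasurableSpace (AdeleRing (𝓞 K) K)] [BorelSpace (AdeleRing (𝓞 K) K)] in
/-- the principal idele of `u ∈ K^×`: `Units.map ι u ∈ principalIdeles K`. [cite: CasselsFrohlich1967, Ch. II §16] -/
theorem units_map_algebraMap_mem_principalIdeles (u : Kˣ) :
    Units.map (algebraMap K (AdeleRing (𝓞 K) K) : K →* AdeleRing (𝓞 K) K) u ∈ principalIdeles K := ⟨u, rfl⟩

end Summit.HodgeConjecture.HodgeConjecture.Cruxes.HLiu418.K2LiuAdelicScalarModulus

end
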